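import Summits.HubbardSuperconductivity.HubbardSuperconductivity.Theorems.AnisotropyChordTransferFibre3FinXBSound

/-!
# Route `AnisotropyChord` / H0 rotor rung: FIN small-`L` EXACT-BLOCK evaluator — soundness of the discs of `φ̂_e(k)`

Soundness layer 2 of `…Fibre3FinXBEval`: the four directions `eDir j` (`x̂, −x̂, ŷ, −ŷ`, the order of `nnList_map_sum`),
their phases at natural momenta (`phase_dir`, `mem_cosAt`, `mem_sinAt`), `mem_betaAt`, the disc predicate `DiscOK x d`
(a centre/radius witness enclosed by `d`), ★ `disc_sound` (`φ̂_e(k)` lies in `disc …`: `phiHat_near_mC`, `phiHat_zero_eq`,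
`mC_re`, `mC_im`), and the two consumers ★ `mem_n2Of` (`|φ̂|²`, `normSq_bracket`, integer square roots) and ★ `mem_crossOf`
(`Re(conj φ̂ φ̂′)`, p2 `blockCrossTerm_holds`).
Prover seat `hubbard-h0-rotor-p3` g5; helper for piece A = stmt-HubbardSuperconductivity-23918 of rung 19089 (`--supports`, helper
class).  WHAT THIS IS NOT: nothing here proves superconductivity in the Hubbard model (rotor TARGET as worded stays FALSE, g15 verdict);
soundness lemmas for the FIN certificates of ONE conditional reduction.  Tree imports only; no sorry, no new axioms.
-/

set_option linter.dupNamespace false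
set_option autoImplicit false

namespace Summit.HubbardSuperconductivity.HubbardSuperconductivity.Theorems.AnisotropyChord.Transfer.Fibre3

namespace FinXB

open scoped BigOperators
open Finset Hole2 FinCell

/-! ## The four directions and their phases -/

/-- the directions in the order of `nnList_map_sum`: `x̂, −x̂, ŷ, −ŷ`. -/
def eDir (L : ℕ) [NeZero L] (j : ℕ) : Tor L :=
  if j = 0 then ex L else if j = 1 then -ex L else if j = 2 then ey L else -ey L

/-- every direction is a nearest neighbour. [folklore] -/
theorem eDir_mem (L : ℕ) [NeZero L] (j : ℕ) : eDir L j ∈ nnList L := by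
  have h : nnList L = [ex L, -ex L, ey L, -ey L] := by
    rw [← neg_ex, ← neg_ey]; rfl
  rw [h]
  unfold eDir
  split_ifs <;> simp

/-- the sum over `nnList` as the sum over `j < 4`. [folklore] -/
theorem nnList_sum_range (L : ℕ) [NeZero L] (h : Tor L → ℝ) :
    ((nnList L).map h).sum = ∑ j ∈ range 4, h (eDir L j) := by
  rw [nnList_map_sum]
  simp only [Finset.sum_range_succ, Finset.sum_range_zero, eDir]
  simp

/-- the phase of a natural momentum against direction `j`: real and imaginary parts are `cos / sin (2π·phIdx/L)`. [folklore] -/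
theorem phase_dir (L : ℕ) [NeZero L] (hL : 3 ≤ L) {j : ℕ} (hj : j < 4) {k1 k2 : ℕ} (hk1 : k1 < L) (hk2 : k2 < L) :
    (phase L ((((k1 : ℕ) : ZMod L), ((k2 : ℕ) : ZMod L))) (eDir L j)).re
        = Real.cos (2 * Real.pi * (phIdx L j k1 k2 : ℕ) / L) ∧
    (phase L ((((k1 : ℕ) : ZMod L), ((k2 : ℕ) : ZMod L))) (eDir L j)).im
        = Real.sin (2 * Real.pi * (phIdx L j k1 k2 : ℕ) / L) := by
  have hL0 : 0 < L := by omega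
  haveI : Fact (1 < L) := ⟨by omega⟩
  have hv1 : (((k1 : ℕ) : ZMod L)).val = k1 := by rw [ZMod.val_natCast, Nat.mod_eq_of_lt hk1]
  have hv2 : (((k2 : ℕ) : ZMod L)).val = k2 := by rw [ZMod.val_natCast, Nat.mod_eq_of_lt hk2]
  have hone : (1 : ZMod L).val = 1 := ZMod.val_one L
  have hneg : (-1 : ZMod L).val = L - 1 := by
    rw [ZMod.neg_val, if_neg one_ne_zero, hone]
  have hzero : (0 : ZMod L).val = 0 := ZMod.val_zero
  have key : ∀ n : ℕ, n % L = phIdx L j k1 k2 →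
      Real.cos (2 * Real.pi * (n : ℝ) / L) = Real.cos (2 * Real.pi * (phIdx L j k1 k2 : ℕ) / L) ∧
      Real.sin (2 * Real.pi * (n : ℝ) / L) = Real.sin (2 * Real.pi * (phIdx L j k1 k2 : ℕ) / L) := by
    intro n hn
    rw [cos_mod L hL0 n, sin_mod L hL0 n, hn]
    exact ⟨rfl, rfl⟩
  rw [RateLemma.phase_re, phase_im, hv1, hv2]
  have hex : ex L = (((1 : ZMod L)), (0 : ZMod L)) := rfl
  have hey : ey L = (((0 : ZMod L)), (1 : ZMod L)) := rfl
  interval_cases j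
  · have e : eDir L 0 = (((1 : ZMod L)), (0 : ZMod L)) := by unfold eDir; simp [hex]
    rw [e]
    refine key (k1 * (1 : ZMod L).val + k2 * (0 : ZMod L).val) ?_
    rw [hone, hzero]; unfold phIdx; simp
  · have e : eDir L 1 = (((-1 : ZMod L)), (0 : ZMod L)) := by unfold eDir; simp [hex]
    rw [e]
    refine key (k1 * (-1 : ZMod L).val + k2 * (0 : ZMod L).val) ?_
    rw [hneg, hzero]; unfold phIdx; simp
  · have e : eDir L 2 = (((0 : ZMod L)), (1 : ZMod L)) := by unfold eDir; simp [hey]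
    rw [e]
    refine key (k1 * (0 : ZMod L).val + k2 * (1 : ZMod L).val) ?_
    rw [hone, hzero]; unfold phIdx; simp
  · have e : eDir L 3 = (((0 : ZMod L)), (-1 : ZMod L)) := by unfold eDir; simp [hey]
    rw [e]
    refine key (k1 * (0 : ZMod L).val + k2 * (-1 : ZMod L).val) ?_
    rw [hneg, hzero]; unfold phIdx; simp

/-- the phase index is below `L`. [folklore] -/
theorem phIdx_lt (L : ℕ) (hL : 0 < L) (j k1 k2 : ℕ) : phIdx L j k1 k2 < L := by
  unfold phIdx
  split_ifs <;> exact Nat.mod_lt _ hL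

/-- `cos(k·e)` from the table. [folklore] -/
theorem mem_cosAt (L : ℕ) [NeZero L] (hL : 3 ≤ L) {j : ℕ} (hj : j < 4) {k1 k2 : ℕ} (hk1 : k1 < L) (hk2 : k2 < L) :
    mem (phase L ((((k1 : ℕ) : ZMod L), ((k2 : ℕ) : ZMod L))) (eDir L j)).re (cosAt L (cosTab L) j k1 k2) := by
  have hL0 : 0 < L := by omega
  rw [(phase_dir L hL hj hk1 hk2).1]
  unfold cosAt
  rw [getIv_cosTab (phIdx_lt L hL0 j k1 k2)]
  exact mem_cosIv hL (phIdx_lt L hL0 j k1 k2)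

/-- `sin(k·e)` from the table at modulus `4L`. [folklore] -/
theorem mem_sinAt (L : ℕ) [NeZero L] (hL : 3 ≤ L) {j : ℕ} (hj : j < 4) {k1 k2 : ℕ} (hk1 : k1 < L) (hk2 : k2 < L) :
    mem (phase L ((((k1 : ℕ) : ZMod L), ((k2 : ℕ) : ZMod L))) (eDir L j)).im (sinAt L (cosTab (4 * L)) j k1 k2) := by
  have hL0 : 0 < L := by omega
  have h4L : 3 ≤ 4 * L := by omega
  have h4L0 : 0 < 4 * L := by omega
  rw [(phase_dir L hL hj hk1 hk2).2, sin_eq_cos_shift L hL0, cos_mod (4 * L) h4L0]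
  unfold sinAt
  have hidx : (4 * phIdx L j k1 k2 + 3 * L) % (4 * L) < 4 * L := Nat.mod_lt _ h4L0
  rw [getIv_cosTab hidx]
  exact mem_cosIv h4L hidx

/-- `β(k) ∈ betaAt`. [folklore] -/
theorem mem_betaAt (L : ℕ) [NeZero L] (hL : 3 ≤ L) {Δ lam2 : ℝ} {f : Tor L → ℝ} {la lb : ℤ}
    (hla : (la : ℝ) ≤ lam2 * ((D : ℤ) : ℝ)) (hlb : lam2 * ((D : ℤ) : ℝ) ≤ (lb : ℝ))
    (hpos : denCellPos L (cosTab L) la lb = true) {S : XBScal} (hS : ScalOK L Δ lam2 f S)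
    {k1 k2 : ℕ} (hk1 : k1 < L) (hk2 : k2 < L) :
    mem (betaK L Δ lam2 f ((((k1 : ℕ) : ZMod L), ((k2 : ℕ) : ZMod L)))) (betaAt S (gresCellTab L (cosTab L) la lb) k1 k2) := by
  unfold betaK betaAt
  have h := mem_iadd (mem_imul hS.2.1 (mem_gAt L hL hla hlb hpos hk1 hk2)) (mem_idivn hS.2.2.2.2.2.1 (by norm_num : (0:ℤ) < 2))
  push_cast at h
  exact h

/-! ## The disc predicate and its soundness -/

/-- `x` lies in a disc whose centre parts and radius are enclosed by `d = (re, im, rad)`. -/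
def DiscOK (x : ℂ) (d : Iv × Iv × Iv) : Prop :=
  ∃ m : ℂ, ∃ r : ℝ, ‖x - m‖ ≤ r ∧ mem m.re d.1 ∧ mem m.im d.2.1 ∧ mem r d.2.2

/-- ★ `φ̂_e(k)` lies in `disc …` for every direction and natural momentum (ground profile, checked cell). [folklore] -/
theorem disc_sound (L : ℕ) [NeZero L] (hL : 5 ≤ L) {Δ lam2 : ℝ} (hΔ0 : 0 ≤ Δ) {f : Tor L → ℝ}
    (hf : IsGroundTwoMagnon L Δ lam2 f) (hlam : 0 < lam2) {la lb : ℤ}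
    (hla : (la : ℝ) ≤ lam2 * ((D : ℤ) : ℝ)) (hlb : lam2 * ((D : ℤ) : ℝ) ≤ (lb : ℝ))
    (hpos : denCellPos L (cosTab L) la lb = true) {S : XBScal} (hS : ScalOK L Δ lam2 f S)
    {j : ℕ} (hj : j < 4) {k1 k2 : ℕ} (hk1 : k1 < L) (hk2 : k2 < L) :
    DiscOK (phiHat L f (eDir L j) ((((k1 : ℕ) : ZMod L), ((k2 : ℕ) : ZMod L))))
      (disc L S (gresCellTab L (cosTab L) la lb) (tTab L (gresCellTab L (cosTab L) la lb)) (cosTab L) (cosTab (4 * L))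
        j k1 k2) := by
  have hL3 : 3 ≤ L := by omega
  unfold disc
  by_cases hk : k1 = 0 ∧ k2 = 0
  · rw [if_pos hk]
    obtain ⟨rfl, rfl⟩ := hk
    have e : ((((0 : ℕ) : ZMod L), (((0 : ℕ) : ZMod L))) : Tor L) = 0 := by ext <;> simp
    rw [e, phiHat_zero_eq L hL hΔ0 hf hlam (eDir_mem L j)]
    refine ⟨((gamPar L Δ lam2 f : ℝ) : ℂ), 0, by simp, ?_, ?_, mem_zero⟩
    · rw [Complex.ofReal_re]; exact hS.2.2.2.2.2.2.2.2.2.1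
    · rw [Complex.ofReal_im]; exact mem_zero
  · rw [if_neg hk]
    have hkne : ((((k1 : ℕ) : ZMod L), ((k2 : ℕ) : ZMod L)) : Tor L) ≠ 0 := by
      rw [Ne, Prod.mk_eq_zero, natCast_zmod_eq_zero L hk1, natCast_zmod_eq_zero L hk2]; exact hk
    refine ⟨mC L Δ lam2 f (eDir L j) _, tauBar L Δ lam2 f / 2,
      phiHat_near_mC L hL hΔ0 hf hlam (eDir_mem L j) hkne, ?_, ?_, ?_⟩
    · -- real part
      rw [mC_re]
      unfold cenRe
      have ht := mem_tAt L hL hΔ0 hf hla hlb hpos hS hk1 hk2 hk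
      have hb := mem_betaAt L hL3 hla hlb hpos hS hk1 hk2
      have hc := mem_cosAt L hL3 hj hk1 hk2
      have h2 : (0 : ℤ) < 2 := by norm_num
      have h := mem_iadd (mem_imul (mem_isub mem_one hc) (mem_isub (mem_idivn ht h2) hb))
        (mem_imul (mem_idivn hS.2.2.2.2.2.2.1 h2) (mem_iadd mem_one hc))
      push_cast at h
      exact h
    · -- imaginary part
      rw [mC_im]
      unfold cenIm
      have ht := mem_tAt L hL hΔ0 hf hla hlb hpos hS hk1 hk2 hk
      have hb := mem_betaAt L hL3 hla hlb hpos hS hk1 hk2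
      have hs := mem_sinAt L hL3 hj hk1 hk2
      have h2 : (0 : ℤ) < 2 := by norm_num
      have h := mem_imul hs (mem_isub (mem_isub (mem_idivn ht h2) hb) (mem_idivn hS.2.2.2.2.2.2.1 h2))
      push_cast at h
      exact h
    · -- radius
      have h := mem_idivn hS.2.2.2.2.2.2.2.2.1 (by norm_num : (0:ℤ) < 2)
      push_cast at h
      exact h

/-! ## Consumers: `|φ̂|²` and the cross term -/

/-- the modulus of the centre lies in `absIv`. [folklore] -/
theorem mem_absIv {m : ℂ} {dre dim : Iv} (hre : mem m.re dre) (him : mem m.im dim) : mem ‖m‖ (absIv dre dim) := by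
  unfold absIv
  refine mem_isqrt (norm_nonneg _) ?_
  rw [Complex.sq_norm, Complex.normSq_apply, ← sq, ← sq]
  exact mem_iadd (mem_isqP hre) (mem_isqP him)

/-- a radius member of `rad` is within `ipm rad`, with either sign. [folklore] -/
theorem mem_ipm {r : ℝ} {rad : Iv} (hr : mem r rad) (h0 : 0 ≤ r) : mem r (ipm rad) ∧ mem (-r) (ipm rad) := by
  obtain ⟨_, h2⟩ := hr
  have hD := D_pos
  have hM : r * ((D : ℤ) : ℝ) ≤ max ((rad.2 : ℤ) : ℝ) 0 := h2.trans (le_max_left _ _)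
  have hr0 : 0 ≤ r * ((D : ℤ) : ℝ) := by positivity
  unfold ipm mem
  push_cast
  refine ⟨⟨by linarith, hM⟩, ⟨by linarith, by linarith⟩⟩

/-- ★ `|φ̂|² ∈ n2Of d` from a disc witness. [folklore] -/
theorem mem_n2Of {x : ℂ} {d : Iv × Iv × Iv} (h : DiscOK x d) : mem (Complex.normSq x) (n2Of d) := by
  obtain ⟨m, r, hxm, hre, him, hrad⟩ := h
  have hr0 : 0 ≤ r := (norm_nonneg _).trans hxm
  have hD := D_pos
  obtain ⟨hlo, hhi⟩ := normSq_bracket hxm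
  have hab := mem_absIv hre him
  obtain ⟨hpm, hmm⟩ := mem_ipm hrad hr0
  have hsum1 := mem_iadd hab hmm     -- ‖m‖ + (−r)
  have hsum2 := mem_iadd hab hpm     -- ‖m‖ + r
  unfold n2Of iclamp
  set w1 : ℤ := max (iadd (absIv d.1 d.2.1) (ipm d.2.2)).1 0 with hw1
  set w2 : ℤ := max (iadd (absIv d.1 d.2.1) (ipm d.2.2)).2 0 with hw2
  -- `w1/D ≤ max(‖m‖ − r, 0)` and `‖m‖ + r ≤ w2/D`
  have hw1le : (w1 : ℝ) ≤ max (‖m‖ - r) 0 * ((D : ℤ) : ℝ) := by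
    rw [hw1]; push_cast
    refine max_le ?_ (by positivity)
    have : ((iadd (absIv d.1 d.2.1) (ipm d.2.2)).1 : ℝ) ≤ (‖m‖ + -r) * ((D : ℤ) : ℝ) := hsum1.1
    calc ((iadd (absIv d.1 d.2.1) (ipm d.2.2)).1 : ℝ) ≤ (‖m‖ - r) * ((D : ℤ) : ℝ) := by linarith
      _ ≤ max (‖m‖ - r) 0 * ((D : ℤ) : ℝ) := by gcongr; exact le_max_left _ _
  have hw2ge : (‖m‖ + r) * ((D : ℤ) : ℝ) ≤ (w2 : ℝ) := by
    rw [hw2]; push_cast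
    exact hsum2.2.trans (le_max_left _ _)
  have hw1nn : (0 : ℝ) ≤ (w1 : ℝ) := by rw [hw1]; push_cast; exact le_max_right _ _
  have hw2nn : (0 : ℝ) ≤ (w2 : ℝ) := by rw [hw2]; push_cast; exact le_max_right _ _
  -- squares of the exact endpoints
  have e1 := mem_imul (mem_ipt w1) (mem_ipt w1)
  have e2 := mem_imul (mem_ipt w2) (mem_ipt w2)
  obtain ⟨e1lo, _⟩ := e1
  obtain ⟨_, e2hi⟩ := e2
  unfold mem
  constructor
  · -- lower end
    have hA : (w1 : ℝ) / ((D : ℤ) : ℝ) ≤ max (‖m‖ - r) 0 := by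
      rw [div_le_iff₀ hD]; exact hw1le
    have hA0 : 0 ≤ (w1 : ℝ) / ((D : ℤ) : ℝ) := by positivity
    have hsq : (w1 : ℝ) / ((D : ℤ) : ℝ) * ((w1 : ℝ) / ((D : ℤ) : ℝ)) ≤ Complex.normSq x := by
      have := mul_le_mul hA hA hA0 ((hA0.trans hA))
      rw [← sq (max _ _)] at this
      exact this.trans hlo
    have : (((max (imul (ipt w1) (ipt w1)).1 0 : ℤ)) : ℝ) ≤ Complex.normSq x * ((D : ℤ) : ℝ) := by
      push_cast
      refine max_le ?_ (mul_nonneg (Complex.normSq_nonneg _) hD.le)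
      exact e1lo.trans (by nlinarith)
    exact this
  · -- upper end
    have hB : ‖m‖ + r ≤ (w2 : ℝ) / ((D : ℤ) : ℝ) := by
      rw [le_div_iff₀ hD]; exact hw2ge
    have hB0 : 0 ≤ ‖m‖ + r := by positivity
    have hsq : Complex.normSq x ≤ (w2 : ℝ) / ((D : ℤ) : ℝ) * ((w2 : ℝ) / ((D : ℤ) : ℝ)) := by
      have := mul_le_mul hB hB hB0 (hB0.trans hB)
      rw [← sq] at this
      exact hhi.trans this
    exact (by nlinarith : Complex.normSq x * ((D : ℤ) : ℝ) ≤ _) |>.trans e2hi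

/-- ★ `Re(conj φ̂ · φ̂′) ∈ crossOf d₁ d₂` from two disc witnesses. [folklore] -/
theorem mem_crossOf {x y : ℂ} {d1 d2 : Iv × Iv × Iv} (hx : DiscOK x d1) (hy : DiscOK y d2) :
    mem (((starRingEnd ℂ) x * y).re) (crossOf d1 d2) := by
  obtain ⟨m, r, hxm, hre, him, hrad⟩ := hx
  obtain ⟨n, s, hyn, hre', him', hrad'⟩ := hy
  have hr0 : 0 ≤ r := (norm_nonneg _).trans hxm
  have hs0 : 0 ≤ s := (norm_nonneg _).trans hyn
  have hD := D_pos
  obtain ⟨hcross, -⟩ := OuterMaj.blockCrossTerm_holds x y m n r s hxm hyn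
  have hbase : mem (((starRingEnd ℂ) m * n).re) (iadd (imul d1.1 d2.1) (imul d1.2.1 d2.2.1)) := by
    have e : ((starRingEnd ℂ) m * n).re = m.re * n.re + m.im * n.im := by
      simp only [Complex.mul_re, Complex.conj_re, Complex.conj_im]; ring
    rw [e]
    exact mem_iadd (mem_imul hre hre') (mem_imul him him')
  have ha1 := mem_absIv hre him
  have ha2 := mem_absIv hre' him'
  obtain ⟨hpm1, -⟩ := mem_ipm hrad hr0
  obtain ⟨hpm2, -⟩ := mem_ipm hrad' hs0
  have hdev := mem_iadd (mem_iadd (mem_imul ha1 hpm2) (mem_imul ha2 hpm1)) (mem_imul hpm1 hpm2)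
  obtain ⟨_, hdevhi⟩ := hdev
  obtain ⟨hb1, hb2⟩ := hbase
  unfold crossOf mem
  simp only []
  set dev := iadd (iadd (imul (absIv d1.1 d1.2.1) (ipm d2.2.2)) (imul (absIv d2.1 d2.2.1) (ipm d1.2.2)))
    (imul (ipm d1.2.2) (ipm d2.2.2)) with hdevdef
  set base := iadd (imul d1.1 d2.1) (imul d1.2.1 d2.2.1) with hbasedef
  have hM : (‖m‖ * s + ‖n‖ * r + r * s) * ((D : ℤ) : ℝ) ≤ max ((dev.2 : ℤ) : ℝ) 0 :=
    hdevhi.trans (le_max_left _ _)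
  have habs := abs_le.mp hcross
  have h3 := mul_le_mul_of_nonneg_right habs.1 hD.le
  have h4 := mul_le_mul_of_nonneg_right habs.2 hD.le
  unfold iadd
  push_cast
  constructor <;> nlinarith [h3, h4, hM, hb1, hb2]

end FinXB

end Summit.HubbardSuperconductivity.HubbardSuperconductivity.Theorems.AnisotropyChord.Transfer.Fibre3
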